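import Mathlib.Analysis.Calculus.ParametricIntegral
import Summits.AtomisticToContinuum.HydrodynamicLimit.Theorems.VitaliAmplitudeTransferAmplitudeTransferWeight

/-!
# Amplitude transfer — the weighted integrals `s ↦ ∫ X F_s dz` along a path of profiles

Step (4) of the Vitali amplitude transfer (route `VitaliAmplitudeTransfer`, item
`AmplitudeTransfer`), continued from the `Weight` file: for the unnormalised local Gibbs weight
`F_s = 𝟙_D f_s^{⊗(N+1)}` along a path of profiles and a measurable multiplier `X` with
`|X| ≤ C_X (1 + 2E)` a.e. on the domain (the partition function for `X = 1`, the numerator of a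
local Gibbs mean for `X = W ∘ Φ_t`):

* `integrable_mul_weight` — integrability of `X F_s` with a Gaussian bound uniform on `[0,1]`;
* `hasDerivAt_integral_weight` — differentiation under the integral sign,
  `d/ds ∫ X F_s = ∫ X (∑ᵢ π_s(zᵢ)) F_s` at interior points of `[0,1]`;
* `continuousOn_integral_weight` — continuity of `s ↦ ∫ X F_s` on `[0,1]`.

The score enters abstractly, through the derivative of the weight (`Weight.hasDerivAt_weight`).
-/

noncomputable section

open MeasureTheory Real Filter Set Topology
open scoped InnerProductSpace ENNReal

namespace Summit.AtomisticToContinuum.HydrodynamicLimit.Theorems.AmplitudeTransfer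

open Literature.MathematicalPhysics.KineticTheory Literature.Analysis.FluidPDE

variable {σ : ℝ} {N : ℕ}

/-! ### Differentiation under the integral sign and continuity of the weighted integrals -/

section Integrals

variable {a θ : ℝ → T3 → ℝ} {u : ℝ → T3 → V3} {B : ℝ}

/-- Integrability of `X F_s` for `s ∈ [0,1]`, for a measurable multiplier `X` with
`|X| ≤ C_X (1 + 2E)` a.e. on the domain. -/
theorem integrable_mul_weight (hB : 1 ≤ B)
    (hcont : ∀ s ∈ Icc (0 : ℝ) 1, Continuous (a s) ∧ Continuous (θ s) ∧ Continuous (u s))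
    (hbd : ∀ s ∈ Icc (0 : ℝ) 1, ∀ x,
      B⁻¹ ≤ a s x ∧ a s x ≤ B ∧ B⁻¹ ≤ θ s x ∧ θ s x ≤ B ∧ ‖u s x‖ ≤ B)
    {X : Config (N + 1) (Fin 3) T3 → ℝ} (hXm : Measurable X) {CX : ℝ}
    (hXb : ∀ᵐ z ∂(volume : Measure (Config (N + 1) (Fin 3) T3)), z ∈ (hardSphereDomain (Torus.geometry (Fin 3)) (N + 1) (hsDiameter σ N)) →
      |X z| ≤ CX * (1 + 2 * configEnergy z))
    {s : ℝ} (hs : s ∈ Icc (0 : ℝ) 1) :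
    Integrable (fun z => X z * ((hardSphereDomain (Torus.geometry (Fin 3)) (N + 1) (hsDiameter σ N)).indicator (tensorPow (N + 1) (localGibbsProfile (a s) (u s) (θ s)))) z) ∧
      ∀ᵐ z ∂(volume : Measure (Config (N + 1) (Fin 3) T3)), ‖X z * ((hardSphereDomain (Torus.geometry (Fin 3)) (N + 1) (hsDiameter σ N)).indicator (tensorPow (N + 1) (localGibbsProfile (a s) (u s) (θ s)))) z‖ ≤
        |CX| * (1 + 16 * B) * (B * (2 * π * B⁻¹) ^ (-(3 : ℝ) / 2) * Real.exp (B / 2)) ^ (N + 1) * Real.exp (-configEnergy z / (4 * B)) := by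
  have hB0 : 0 < B := by linarith
  have hbound : ∀ᵐ z ∂(volume : Measure (Config (N + 1) (Fin 3) T3)),
      ‖X z * ((hardSphereDomain (Torus.geometry (Fin 3)) (N + 1) (hsDiameter σ N)).indicator (tensorPow (N + 1) (localGibbsProfile (a s) (u s) (θ s)))) z‖ ≤
        |CX| * (1 + 16 * B) * (B * (2 * π * B⁻¹) ^ (-(3 : ℝ) / 2) * Real.exp (B / 2)) ^ (N + 1) * Real.exp (-configEnergy z / (4 * B)) := by
    filter_upwards [hXb] with z hz
    have hE := configEnergy_nonneg' z
    obtain ⟨hw0, hwle⟩ := weight_nonneg_le (σ := σ) (N := N) hB (hbd s hs) z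
    by_cases hzD : z ∈ (hardSphereDomain (Torus.geometry (Fin 3)) (N + 1) (hsDiameter σ N))
    · have hX := hz hzD
      rw [norm_mul, Real.norm_eq_abs, Real.norm_eq_abs, abs_of_nonneg hw0]
      have h1 : |X z| ≤ |CX| * ((1 + 16 * B) * Real.exp (configEnergy z / (8 * B))) :=
        hX.trans ((mul_le_mul_of_nonneg_right (le_abs_self CX) (by positivity)).trans
          (mul_le_mul_of_nonneg_left (one_add_two_mul_le_exp hB hE) (abs_nonneg _)))
      calc |X z| * ((hardSphereDomain (Torus.geometry (Fin 3)) (N + 1) (hsDiameter σ N)).indicator (tensorPow (N + 1) (localGibbsProfile (a s) (u s) (θ s)))) z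
          ≤ (|CX| * ((1 + 16 * B) * Real.exp (configEnergy z / (8 * B)))) *
              ((B * (2 * π * B⁻¹) ^ (-(3 : ℝ) / 2) * Real.exp (B / 2)) ^ (N + 1) * Real.exp (-configEnergy z / (2 * B))) :=
            mul_le_mul h1 hwle hw0 (by positivity)
        _ = |CX| * (1 + 16 * B) * (B * (2 * π * B⁻¹) ^ (-(3 : ℝ) / 2) * Real.exp (B / 2)) ^ (N + 1) *
              (Real.exp (configEnergy z / (8 * B)) * Real.exp (-configEnergy z / (2 * B))) := by ring
        _ ≤ |CX| * (1 + 16 * B) * (B * (2 * π * B⁻¹) ^ (-(3 : ℝ) / 2) * Real.exp (B / 2)) ^ (N + 1) * Real.exp (-configEnergy z / (4 * B)) := by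
            gcongr
            rw [← Real.exp_add]
            apply Real.exp_le_exp.2
            have hid : -configEnergy z / (4 * B) - (configEnergy z / (8 * B) +
                -configEnergy z / (2 * B)) = configEnergy z / (8 * B) := by
              field_simp; ring
            have hnn : 0 ≤ configEnergy z / (8 * B) := by positivity
            linarith
    · simp only [Set.indicator_of_notMem hzD, mul_zero, norm_zero]
      positivity
  refine ⟨?_, hbound⟩
  refine Integrable.mono' (((integrable_exp_neg_configEnergy hB0).const_mul _)) ?_ hbound
  exact (hXm.mul (measurable_weight (hcont s hs).1 (hcont s hs).2.1 (hcont s hs).2.2)).aestronglyMeasurable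

/-- **Differentiation under the integral sign**: at an interior point `s₀ ∈ (0,1)` of a path of
profiles within two-sided bounds `B` on `[0,1]`, whose weight has the `s`-derivative
`(∑ᵢ π_s(zᵢ)) F_s(z)` on `(0,1)` for a continuous one-body score `π_s` of quadratic velocity growth,
`d/ds ∫ X F_s dz = ∫ X (∑ᵢ π_{s₀}(zᵢ)) F_{s₀} dz`, and the derivative integrand is integrable. -/
theorem hasDerivAt_integral_weight (hB : 1 ≤ B)
    (hcont : ∀ s ∈ Icc (0 : ℝ) 1, Continuous (a s) ∧ Continuous (θ s) ∧ Continuous (u s))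
    (hbd : ∀ s ∈ Icc (0 : ℝ) 1, ∀ x,
      B⁻¹ ≤ a s x ∧ a s x ≤ B ∧ B⁻¹ ≤ θ s x ∧ θ s x ≤ B ∧ ‖u s x‖ ≤ B)
    {sc : ℝ → T3 × V3 → ℝ} {K : ℝ} (hK0 : 0 ≤ K) (hπc : ∀ s ∈ Ioo (0 : ℝ) 1, Continuous (sc s))
    (hπb : ∀ s ∈ Ioo (0 : ℝ) 1, ∀ y, |sc s y| ≤ K * (1 + ‖y.2‖ ^ 2))
    (hπd : ∀ s ∈ Ioo (0 : ℝ) 1, ∀ z : Config (N + 1) (Fin 3) T3,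
      HasDerivAt (fun r => ((hardSphereDomain (Torus.geometry (Fin 3)) (N + 1) (hsDiameter σ N)).indicator (tensorPow (N + 1) (localGibbsProfile (a r) (u r) (θ r)))) z) ((∑ i, sc s (z i)) * ((hardSphereDomain (Torus.geometry (Fin 3)) (N + 1) (hsDiameter σ N)).indicator (tensorPow (N + 1) (localGibbsProfile (a s) (u s) (θ s)))) z) s)
    {X : Config (N + 1) (Fin 3) T3 → ℝ} (hXm : Measurable X) {CX : ℝ}
    (hXb : ∀ᵐ z ∂(volume : Measure (Config (N + 1) (Fin 3) T3)), z ∈ (hardSphereDomain (Torus.geometry (Fin 3)) (N + 1) (hsDiameter σ N)) →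
      |X z| ≤ CX * (1 + 2 * configEnergy z))
    {s₀ : ℝ} (hs₀ : s₀ ∈ Ioo (0 : ℝ) 1) :
    Integrable (fun z => X z * ((∑ i, sc s₀ (z i)) * ((hardSphereDomain (Torus.geometry (Fin 3)) (N + 1) (hsDiameter σ N)).indicator (tensorPow (N + 1) (localGibbsProfile (a s₀) (u s₀) (θ s₀)))) z)) ∧
    HasDerivAt (fun s => ∫ z, X z * ((hardSphereDomain (Torus.geometry (Fin 3)) (N + 1) (hsDiameter σ N)).indicator (tensorPow (N + 1) (localGibbsProfile (a s) (u s) (θ s)))) z)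
      (∫ z, X z * ((∑ i, sc s₀ (z i)) * ((hardSphereDomain (Torus.geometry (Fin 3)) (N + 1) (hsDiameter σ N)).indicator (tensorPow (N + 1) (localGibbsProfile (a s₀) (u s₀) (θ s₀)))) z)) s₀ := by
  have hB0 : 0 < B := by linarith
  have hIo : Ioo (0 : ℝ) 1 ∈ 𝓝 s₀ := Ioo_mem_nhds hs₀.1 hs₀.2
  have hsub : Ioo (0 : ℝ) 1 ⊆ Icc 0 1 := Ioo_subset_Icc_self
  -- the bound
  set bound : Config (N + 1) (Fin 3) T3 → ℝ := fun z =>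
    |CX| * K * ((N : ℝ) + 1) * (1 + 16 * B) ^ 2 * (B * (2 * π * B⁻¹) ^ (-(3 : ℝ) / 2) * Real.exp (B / 2)) ^ (N + 1) *
      Real.exp (-configEnergy z / (4 * B)) with hbound
  refine hasDerivAt_integral_of_dominated_loc_of_deriv_le (F' := fun s z => X z *
      ((∑ i, sc s (z i)) * ((hardSphereDomain (Torus.geometry (Fin 3)) (N + 1) (hsDiameter σ N)).indicator (tensorPow (N + 1) (localGibbsProfile (a s) (u s) (θ s)))) z)) (bound := bound) hIo ?_ ?_ ?_ ?_ ?_ ?_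
  · -- measurability of `X F_s` near `s₀`
    filter_upwards [hIo] with s hs
    exact (hXm.mul (measurable_weight (hcont s (hsub hs)).1 (hcont s (hsub hs)).2.1
      (hcont s (hsub hs)).2.2)).aestronglyMeasurable
  · -- integrability at `s₀`
    exact (integrable_mul_weight hB hcont hbd hXm hXb (hsub hs₀)).1
  · -- measurability of the derivative integrand at `s₀`
    exact (hXm.mul ((measurable_sum_comp (hπc s₀ hs₀)).mul (measurable_weight
      (hcont s₀ (hsub hs₀)).1 (hcont s₀ (hsub hs₀)).2.1 (hcont s₀ (hsub hs₀)).2.2))).aestronglyMeasurable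
  · -- domination on `(0,1)`
    filter_upwards [hXb] with z hz s hs
    have hE := configEnergy_nonneg' z
    obtain ⟨hw0, hwle⟩ := weight_nonneg_le (σ := σ) (N := N) hB (hbd s (hsub hs)) z
    by_cases hzD : z ∈ (hardSphereDomain (Torus.geometry (Fin 3)) (N + 1) (hsDiameter σ N))
    · have hX := hz hzD
      have hS := abs_sum_le_of_growth (N := N) (hπb s hs) z
      rw [norm_mul, norm_mul, Real.norm_eq_abs, Real.norm_eq_abs, Real.norm_eq_abs,
        abs_of_nonneg hw0]
      have hX' : |X z| ≤ |CX| * (1 + 2 * configEnergy z) :=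
        hX.trans (mul_le_mul_of_nonneg_right (le_abs_self CX) (by positivity))
      have hS' : |∑ i, sc s (z i)| ≤ K * (((N : ℝ) + 1) * (1 + 2 * configEnergy z)) :=
        hS.trans (mul_le_mul_of_nonneg_left (by nlinarith) hK0)
      have hpoly : (1 + 2 * configEnergy z) * (1 + 2 * configEnergy z) *
          Real.exp (-configEnergy z / (2 * B)) ≤
          (1 + 16 * B) ^ 2 * Real.exp (-configEnergy z / (4 * B)) := by
        have h1 := one_add_two_mul_le_exp hB hE
        have h0 : 0 ≤ 1 + 2 * configEnergy z := by positivity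
        calc (1 + 2 * configEnergy z) * (1 + 2 * configEnergy z) * Real.exp (-configEnergy z / (2 * B))
            ≤ ((1 + 16 * B) * Real.exp (configEnergy z / (8 * B))) *
                ((1 + 16 * B) * Real.exp (configEnergy z / (8 * B))) *
                Real.exp (-configEnergy z / (2 * B)) := by
              gcongr
          _ = (1 + 16 * B) ^ 2 * (Real.exp (configEnergy z / (8 * B)) *
                Real.exp (configEnergy z / (8 * B)) * Real.exp (-configEnergy z / (2 * B))) := by ring
          _ = (1 + 16 * B) ^ 2 * Real.exp (-configEnergy z / (4 * B)) := by
              rw [← Real.exp_add, ← Real.exp_add]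
              congr 2
              field_simp
              ring
      calc |X z| * (|∑ i, sc s (z i)| * ((hardSphereDomain (Torus.geometry (Fin 3)) (N + 1) (hsDiameter σ N)).indicator (tensorPow (N + 1) (localGibbsProfile (a s) (u s) (θ s)))) z)
          ≤ (|CX| * (1 + 2 * configEnergy z)) * ((K * (((N : ℝ) + 1) * (1 + 2 * configEnergy z))) *
              ((B * (2 * π * B⁻¹) ^ (-(3 : ℝ) / 2) * Real.exp (B / 2)) ^ (N + 1) * Real.exp (-configEnergy z / (2 * B)))) :=
            mul_le_mul hX' (mul_le_mul hS' hwle hw0 (by positivity)) (by positivity) (by positivity)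
        _ = |CX| * K * ((N : ℝ) + 1) * (B * (2 * π * B⁻¹) ^ (-(3 : ℝ) / 2) * Real.exp (B / 2)) ^ (N + 1) *
              ((1 + 2 * configEnergy z) * (1 + 2 * configEnergy z) *
                Real.exp (-configEnergy z / (2 * B))) := by ring
        _ ≤ |CX| * K * ((N : ℝ) + 1) * (B * (2 * π * B⁻¹) ^ (-(3 : ℝ) / 2) * Real.exp (B / 2)) ^ (N + 1) *
              ((1 + 16 * B) ^ 2 * Real.exp (-configEnergy z / (4 * B))) := by gcongr
        _ = bound z := by rw [hbound]; ring
    · simp only [Set.indicator_of_notMem hzD, mul_zero, norm_zero, hbound]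
      positivity
  · -- integrability of the bound
    exact (integrable_exp_neg_configEnergy hB0).const_mul _
  · -- pointwise differentiability on `(0,1)`
    exact Eventually.of_forall fun z s hs => (hπd s hs z).const_mul (X z)

/-- **Continuity of the weighted integrals on `[0,1]`** (dominated convergence): for a path of
profiles continuous in `s` on `[0,1]` for each `x`, continuous in `x`, within two-sided bounds. -/
theorem continuousOn_integral_weight (hB : 1 ≤ B)
    (hcont : ∀ s ∈ Icc (0 : ℝ) 1, Continuous (a s) ∧ Continuous (θ s) ∧ Continuous (u s))
    (hconts : ∀ x, ContinuousOn (fun s => a s x) (Icc 0 1) ∧ ContinuousOn (fun s => θ s x) (Icc 0 1) ∧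
      ContinuousOn (fun s => u s x) (Icc 0 1))
    (hbd : ∀ s ∈ Icc (0 : ℝ) 1, ∀ x,
      B⁻¹ ≤ a s x ∧ a s x ≤ B ∧ B⁻¹ ≤ θ s x ∧ θ s x ≤ B ∧ ‖u s x‖ ≤ B)
    {X : Config (N + 1) (Fin 3) T3 → ℝ} (hXm : Measurable X) {CX : ℝ}
    (hXb : ∀ᵐ z ∂(volume : Measure (Config (N + 1) (Fin 3) T3)), z ∈ (hardSphereDomain (Torus.geometry (Fin 3)) (N + 1) (hsDiameter σ N)) →
      |X z| ≤ CX * (1 + 2 * configEnergy z)) :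
    ContinuousOn (fun s => ∫ z, X z * ((hardSphereDomain (Torus.geometry (Fin 3)) (N + 1) (hsDiameter σ N)).indicator (tensorPow (N + 1) (localGibbsProfile (a s) (u s) (θ s)))) z) (Icc 0 1) := by
  have hB0 : 0 < B := by linarith
  refine continuousOn_of_dominated (bound := fun z =>
    |CX| * (1 + 16 * B) * (B * (2 * π * B⁻¹) ^ (-(3 : ℝ) / 2) * Real.exp (B / 2)) ^ (N + 1) * Real.exp (-configEnergy z / (4 * B)))
    (fun s hs => ?_) (fun s hs => (integrable_mul_weight hB hcont hbd hXm hXb hs).2)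
    ((integrable_exp_neg_configEnergy hB0).const_mul _) ?_
  · exact (hXm.mul (measurable_weight (hcont s hs).1 (hcont s hs).2.1
      (hcont s hs).2.2)).aestronglyMeasurable
  · refine Eventually.of_forall fun z => ?_
    refine ContinuousOn.mul continuousOn_const ?_
    by_cases hzD : z ∈ (hardSphereDomain (Torus.geometry (Fin 3)) (N + 1) (hsDiameter σ N))
    · simp only [Set.indicator_of_mem hzD]
      change ContinuousOn (fun s => ∏ i, localGibbsProfile (a s) (u s) (θ s) (z i)) (Icc 0 1)
      refine continuousOn_finsetProd _ fun i _ => ?_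
      unfold localGibbsProfile localMaxwellian
      have hθpos : ∀ s ∈ Icc (0 : ℝ) 1, 0 < θ s (z i).1 := fun s hs =>
        lt_of_lt_of_le (inv_pos.2 hB0) (hbd s hs _).2.2.1
      refine (hconts _).1.mul ((continuousOn_const.mul ?_).mul ?_)
      · refine ContinuousOn.rpow_const (continuousOn_const.mul (hconts _).2.1) fun s hs => ?_
        exact Or.inl (by have := hθpos s hs; positivity)
      · refine Real.continuous_exp.comp_continuousOn ?_
        refine ContinuousOn.div ?_ (continuousOn_const.mul (hconts _).2.1) fun s hs => ?_
        · exact ((continuousOn_const.sub (hconts _).2.2).norm.pow 2).neg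
        · exact mul_ne_zero two_ne_zero (hθpos s hs).ne'
    · simp only [Set.indicator_of_notMem hzD]
      exact continuousOn_const

end Integrals

end Summit.AtomisticToContinuum.HydrodynamicLimit.Theorems.AmplitudeTransfer

end
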